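import Literature.MathematicalPhysics.QuantumFieldTheory.Balaban1983to89.Node00.N24GlueStage9C
import Literature.MathematicalPhysics.QuantumFieldTheory.Balaban1983to89.Node00.Record10

/-!
# NODE N24 · (B2) `B16.EndStatementBPrinted D.C` AT NODE 00's STAGE-10 RECORD `IsRecordOfRecord₁₀C` (`Node00/Record10`, seat node00-def-T: the β of record READ
# THROUGH THE CONTINUOUS-VERSION TRANSPORT `TcOfRecord`, the action side T-generic at `TcOfRecord` with def-χ's `chiFixed7`, the β-version proviso `contT`
# inside `Provisos₁₀`) — transported through the SHADOW (`D₅.C = D.C`), the carrier children at the record's own parameters by name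

TRACK A (YM-PLAN §2d, node N24 of 28 = binder B2 `hB : B16.EndStatementBPrinted D.C`), seat `pub-ymgap-dag-n24-a` (-a KNIT-BY-NAME; ROSTER-D0062 re-point; INTENT-18,
trigger (t1) = `Record10` ACCEPT).  EIGHTEENTH N24 module, a NEW importing one (append-only growth; modules 1–17 untouched).  THEOREMS ONLY, def-free, sorry-free,
standard axioms.

WHY.  `IsRecordOfRecord₁₀C F N D w` (admissible Stage-9 parameters `θ` WITH THEIR DISPLAYED STAGE-10 PROVISOS `h` — the Stage-9 tower clauses restated along the ONE history
`gOfRecord₁₀ = genSeq (betaOfRecord₉c θ) g₀` + the β-VERSION PROVISO `contT : θ.toStage8Params.HasContTransportAlong` —, `D = datumOfRecord₁₀ F N θ h`, world bound to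
`D.C`, window `0 < w.γ ≤ θ.γ`, `w.L = θ.L`, upstream block `upOfRecord₅C F N (θ.toStage5₁₀ F N)` with the 𝐑-carriers PINNED along the tower of record) does NOT refine
`₉C` at the datum (located, `Record10` header: β differs ⇒ histories, densities, flows differ) — but, exactly as at Stage 9, every ₁₀C world IS a `₅C` record AT THE
SHADOW DATUM `D₅` with `D₅.C = D.C`, `D₅.βfun = D.βfun` (`exists_isRecordOfRecord₅C_of_isRecordOfRecord₁₀C`).  (B2) reads `.C` only; module 5's composition
`N24_at_record₅C` runs at the shadow with N03 a theorem there (`N03_at_record₅C`) and N01 N02 N04 inside; the carrier children N05 N06 N07 N08 N10 N12 are fed AT THE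
RECORD'S OWN `θ` through θ-keyed PINNED CARRIER SOCKETS over `θ.toStage5₁₀ F N` (whose residual groups X ∕ Y ∕ Z ∕ W ARE `θ.res.X ∕ Y ∕ Z ∕ W`, `rfl`), each EQUIVALENT at a
₁₀C record to the world's own leaf (§0); **N13** enters WORLD-LEVEL through the record's 𝐑-leaf `∀ P, (w.up P).rOperation` — which at Stage 10 UNFOLDS to law transport
along the tower of record, `∀ k < K, TLaw₁₀ θ P k → SLaw₁₀ θ P (k+1)` (`Record10.rOperation_upOfRecord₅C_stage10_iff`, `exists_rOperation_iff_of_isRecordOfRecord₁₀C`) — and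
the five [III] Cor.-3 leaves at `(D.C, w.γ)` for SOME exponent letters (seat dag-n13-a's `B16NodeKnitRecordPinned.b16_main_of_isRecordOfRecord₅C_of_leaf` at the shadow,
`D₅.C = D.C` consumed); **N09 and N11 stay by-name binders** `∀ P, Dag.B12_main ∕ Dag.B14_main (leavesP w P)` in this module: their Stage-10 faces (seat dag-n09-a's
`B12NodeKnitRecord10` — the ₁₀ twin of `B12NodeKnitRecord9` at `TcOfRecord ∕ chiFixed7` with the `hcomp` binder gone, after `B12NodeKnitContinuousTransport`; the n11 ∕ n13 lineages' `…Record10` junction with (S0) (S1ᵀ) (R₁₀) (UV₁₀) at `SLaw₁₀ ∕ TLaw₁₀ ∕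
densOfRecord₁₀`) have `Record10` ACCEPT as their trigger and are consumed by name in an append-only successor of this file when they land (LOCATED, not restated here).

WHAT THIS FILE PROVES.
§0 `N24_forall_pinned_b8Leaf_iff₁₀C` ∕ `…b9…` ∕ `…b11…` ∕ `…b15…` (θ-keyed socket over `θ.toStage5₁₀` ↔ world leaf at a ₁₀C record); `N24_forall_pinned_rOperation_iff₁₀C`
   (the 𝐑-leaf ↔ law transport `TLaw₁₀ k → SLaw₁₀ (k+1)` along the Stage-10 tower at the presenting θ — N13's (R) slot located); `N24_b6_main_of_isRecordOfRecord₁₀C`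
   (N03 at ₁₀C, a theorem); `N24_b8 ∕ b9 ∕ b11 ∕ b10 ∕ b13 ∕ b15_main_of_isRecordOfRecord₁₀C_of_slot` (N05 N06 N07 N08 N10 N12 from their θ-keyed sockets ∕ slots).
§1 `N24_at_record₁₀C` — the composition ENGINE at ₁₀C (nine by-name binders + β-box ⇒ (B2); shadow, `D₅.C = D.C` CONSUMED); `N24_at_record₁₀C_of_N13_exists`;
   **`N24_at_record₁₀C_knit_pinned`** — (B2) at a ₁₀C record with the six carrier children at θ by name, N13 world-level (𝐑-leaf + ∃ Cor.-3 leaves), N09 N11 by-name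
   binders: hypothesis list = WHICH CHILD BLOCKS at ₁₀C, kernel form.
§2 THE β OF RECORD AT STAGE 10 READ AT THE MERGED β OVER THE CONTINUOUS-VERSION TRANSPORT: `N24_betaLowerH_iff_mergedT` ∕ `N24_betaUpperH_iff_mergedT` (any transport
   family `T`: a box bound on `betaOfRecord₈T F N T θ` over `]0, γ']^{k+1}`, `γ' ≤ θ.γ`, IS the same bound on `betaMerged F (mergedTermFamilyMatT F N T (chiFixed7 F N θ.ν) θ.εbg)
   θ.ρ8 θ.bV` — `betaOfMerged_of_mem` + `FlowStep.box_mono`, module 10's ten lines, T-generic), `N24_betaLowerH_iff_merged₁₀` ∕ `N24_betaUpperH_iff_merged₁₀` (at a ₁₀C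
   presentation: `D.βfun = betaOfRecord₁₀ θ = betaOfRecord₉c θ = betaOfRecord₈T (TcOfRecord) θ.toStage8Params`, def-T's face `βfun_datumOfRecord₁₀_eq_betaOfRecord₈T` by
   name), `N24_at_record₁₀C_knit_of_betaMerged_pinned`.
   β-VERSION SENTENCE (director RIDER №6 ∕ LINE №44 ∕ №45 (2), EXECUTED at Stage 10): β here = the Hessian-at-1 of the T-generic effective action READ THROUGH THE
   CONTINUOUS-VERSION TRANSPORT `TcOfRecord` with def-χ's fixed-threshold χ — under the record's proviso `contT` every β-input is a version of the kernel transform AND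
   continuous, so its point values are DETERMINED by the a.e.-class (`Record10.betaInput_ae_eq_and_continuous₁₀`, `exists_betaVersion_of_isRecordOfRecord₁₀C`); the
   β-side binders (lower `b > 0` UNPRINTED T09.F = NODE O; upper β⁺ [Balaban1987RG1] p. 264; B3 ∕ B4 the N25 ∕ N26 lanes) are bounds on THIS β.
§3 `N24_stabilityB_itemShape₁₀C_knit_pinned` — the item body (stmt-QuantumFields-19183, rev 0) in its literal shape at general `N` at a ₁₀C record.
§4 `N24_isRecordOfRecord₁₀C_reletter` — ₁₀C is closed under γ-lowering re-lettering of the world (`hRL` of design E; not instantiated — X ∕ Y ∕ Z ∕ W residual at ₁₀,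
   `Record10Carriers` the carrier-pinning successor).
§5 `N24_leaves_iff_binders₁₀C` — logical status of the socket display at ₁₀C (module 14's `N24_leaves_iff_binders₅C` through the shadow).

VACUITY ∕ A1 (director LINE №45 (3), RIDER №7).  `IsRecordOfRecord₁₀C` is inhabited iff SOME admissible `θ` satisfies `Stage9Params.Provisos₁₀` (the Stage-9 tower
clauses along the new history AND `contT`) — K0 at Stage 10, OWED at `N ≥ 2`; every theorem below is a per-record implication and a ∀-form over ₁₀C is NOT-A-DISCHARGE.
NOT a restatement of `Record10.endStatementBPrinted_of_isRecordOfRecord₁₀C_of_nodes` (blanket `Nodes` hypothesis): the content here is the PINNED-children form.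
HONEST FRAMING: kernel bookkeeping BY NAME; nothing of Bałaban's asserted; N24 COMPOSITE — no discharge, no count; one finite T⁴ programme at fixed ε; NOT
continuum ∕ ℝ⁴ ∕ OS ∕ mass gap ∕ Clay.
-/

noncomputable section

open scoped Matrix.Norms.L2Operator

namespace Literature.MathematicalPhysics.QuantumFieldTheory.Balaban1983to89.Node00

open DagBinding T4Continuum T4DatumAssembly FlowStepRuns AveragingRT
open FlowStep (box_mono)

variable {F : T4Family} {N : ℕ} [NeZero N] {D : FiniteEpsData F (SU N)} {w : WorldP}

/-! ## §0. θ-keyed pinned carrier sockets over `θ.toStage5₁₀` ↔ the world's leaves; N03 a theorem at ₁₀C; the carrier children from their sockets -/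

/-- **The θ-keyed [B8] socket IS the world's leaf** at a ₁₀C record: «for the admissible Stage-9 parameters with Stage-10 provisos presenting the datum and binding the
world over their Stage-10 view, the [B8] leaf `B8LeafR` over the [B8] group of the RESIDUAL bundle `θ.res.X P`» ↔ `∀ P, (w.up P).b8` (`upOfRecord₅C_b8_b9_b11` at
`θ.toStage5₁₀ F N`, whose `X` group IS `θ.res.X`, `rfl`). [cite: Balaban1985RegularSpaces, Lemma 1 – Thm 8 pp.79–101 (the leaf; bookkeeping: the pinned socket at Stage 10)] -/
theorem N24_forall_pinned_b8Leaf_iff₁₀C (h : IsRecordOfRecord₁₀C F N D w) :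
    (∀ (θ : Stage9Params F N) (hP : θ.Provisos₁₀), θ.Admissible → D = datumOfRecord₁₀ F N θ hP →
        (∀ P, w.up P = upOfRecord₅C F N (θ.toStage5₁₀ F N) P) → ∀ P : B12.RunParams,
        B8LeafR (θ.res.X P).d8 (θ.res.X P).L8 (θ.res.X P).C₂ (θ.res.X P).B₁' (θ.res.X P).B₀' (θ.res.X P).B₁ (θ.res.X P).B₂ (θ.res.X P).c₁
          (θ.res.X P).inp8 (θ.res.X P).B₀β (θ.res.X P).loc8 (θ.res.X P).fam8R (θ.res.X P).lan8 (θ.res.X P).cub8 (θ.res.X P).toAxial8) ↔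
      ∀ P : B12.RunParams, (w.up P).b8 := by
  refine ⟨fun hX P => ?_, fun hw θ' hP' _ _ hup' P => ?_⟩
  · obtain ⟨θ, hP, hθ, hD, -, -, -, hup⟩ := h
    rw [hup P]
    exact (B11LeafUnpinnedRecord.upOfRecord₅C_b8_b9_b11 (θ.toStage5₁₀ F N) P).1.2 (hX θ hP hθ hD hup P)
  · have h8 : (w.up P).b8 := hw P
    rw [hup' P] at h8
    exact (B11LeafUnpinnedRecord.upOfRecord₅C_b8_b9_b11 (θ'.toStage5₁₀ F N) P).1.1 h8

/-- **The θ-keyed [B9] socket IS the world's leaf** at a ₁₀C record: «… `B9LeafX (θ.res.Y P)`» ↔ `∀ P, (w.up P).b9` (the `Y` group is residual at Stage 10).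
[cite: Balaban1985BackgroundPropagators, Thms 3.1–3.15 pp.397–432 (the leaf; bookkeeping: the pinned socket at Stage 10)] -/
theorem N24_forall_pinned_b9Leaf_iff₁₀C (h : IsRecordOfRecord₁₀C F N D w) :
    (∀ (θ : Stage9Params F N) (hP : θ.Provisos₁₀), θ.Admissible → D = datumOfRecord₁₀ F N θ hP →
        (∀ P, w.up P = upOfRecord₅C F N (θ.toStage5₁₀ F N) P) → ∀ P : B12.RunParams, B9LeafX (θ.res.Y P)) ↔
      ∀ P : B12.RunParams, (w.up P).b9 := by
  refine ⟨fun hY P => ?_, fun hw θ' hP' _ _ hup' P => ?_⟩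
  · obtain ⟨θ, hP, hθ, hD, -, -, -, hup⟩ := h
    rw [hup P]
    exact (B11LeafUnpinnedRecord.upOfRecord₅C_b8_b9_b11 (θ.toStage5₁₀ F N) P).2.1.2 (hY θ hP hθ hD hup P)
  · have h9 : (w.up P).b9 := hw P
    rw [hup' P] at h9
    exact (B11LeafUnpinnedRecord.upOfRecord₅C_b8_b9_b11 (θ'.toStage5₁₀ F N) P).2.1.1 h9

/-- **The θ-keyed [B11] socket IS the world's leaf** at a ₁₀C record: «… `B11Leaf (θ.res.Z P)`» ↔ `∀ P, (w.up P).b11` (the `Z` group is residual at Stage 10).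
[cite: Balaban1985Variational, Thm 1 p.279, Props 2–9 pp.281–309 (the leaf; bookkeeping: the pinned socket at Stage 10)] -/
theorem N24_forall_pinned_b11Leaf_iff₁₀C (h : IsRecordOfRecord₁₀C F N D w) :
    (∀ (θ : Stage9Params F N) (hP : θ.Provisos₁₀), θ.Admissible → D = datumOfRecord₁₀ F N θ hP →
        (∀ P, w.up P = upOfRecord₅C F N (θ.toStage5₁₀ F N) P) → ∀ P : B12.RunParams, B11Leaf (θ.res.Z P)) ↔
      ∀ P : B12.RunParams, (w.up P).b11 := by
  refine ⟨fun hZ P => ?_, fun hw θ' hP' _ _ hup' P => ?_⟩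
  · obtain ⟨θ, hP, hθ, hD, -, -, -, hup⟩ := h
    rw [hup P]
    exact (B11LeafUnpinnedRecord.upOfRecord₅C_b8_b9_b11 (θ.toStage5₁₀ F N) P).2.2.2 (hZ θ hP hθ hD hup P)
  · have h11 : (w.up P).b11 := hw P
    rw [hup' P] at h11
    exact (B11LeafUnpinnedRecord.upOfRecord₅C_b8_b9_b11 (θ'.toStage5₁₀ F N) P).2.2.1 h11

/-- **The θ-keyed [IV] socket IS the world's leaf** at a ₁₀C record: «… `B15Leaf (θ.res.W P)`» ↔ `∀ P, (w.up P).rBasicStep` (the `W` group is residual at Stage 10).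
[cite: Balaban1989LargeFieldI, Prop. 1 p.194, (0.4)–(0.6) p.176 (the leaf; bookkeeping: the pinned socket at Stage 10)] -/
theorem N24_forall_pinned_b15Leaf_iff₁₀C (h : IsRecordOfRecord₁₀C F N D w) :
    (∀ (θ : Stage9Params F N) (hP : θ.Provisos₁₀), θ.Admissible → D = datumOfRecord₁₀ F N θ hP →
        (∀ P, w.up P = upOfRecord₅C F N (θ.toStage5₁₀ F N) P) → ∀ P : B12.RunParams, B15Leaf (θ.res.W P)) ↔
      ∀ P : B12.RunParams, (w.up P).rBasicStep := by
  refine ⟨fun hW P => ?_, fun hw θ' hP' _ _ hup' P => ?_⟩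
  · obtain ⟨θ, hP, hθ, hD, -, -, -, hup⟩ := h
    rw [hup P]
    exact (B15LeafKnitRecord7.rBasicStep_upOfRecord₅C_iff (θ.toStage5₁₀ F N) P).2 (hW θ hP hθ hD hup P)
  · have h15 : (w.up P).rBasicStep := hw P
    rw [hup' P] at h15
    exact (B15LeafKnitRecord7.rBasicStep_upOfRecord₅C_iff (θ'.toStage5₁₀ F N) P).1 h15

/-- **The record's 𝐑-leaf IS law transport along the Stage-10 tower of record** (the located form of N13's (R) slot at the objects of record, seat node00-def-T's
`Record10.rOperation_upOfRecord₅C_stage10_iff` ∕ `exists_rOperation_iff_of_isRecordOfRecord₁₀C`, displayed as a socket): at a ₁₀C record, «for the presenting parameters,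
`∀ k < K, TLaw₁₀ θ P k → SLaw₁₀ θ P (k+1)` at every run» ↔ `∀ P, (w.up P).rOperation` — the hypothesis `hR` of §1's knit.  FORMAT FACE (director RIDER №38): `SLaw₁₀ ∕ TLaw₁₀` READ
the residual format predicates `S218 ∕ ScorrLaw` at `densOfRecord₁₀ ∕ tdensOfRecord₁₀`; their content is booked over `Sect2FormOfRecord` ∕ `Record11`.
[cite: Balaban1988Convergent, p.244 and remark p.262, Def. 3 p.279; Balaban1989LargeFieldII, Thm 1 p.355 (the 𝐑-leaf; bookkeeping at the Stage-10 record)] -/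
theorem N24_forall_pinned_rOperation_iff₁₀C (h : IsRecordOfRecord₁₀C F N D w) :
    (∀ (θ : Stage9Params F N) (hP : θ.Provisos₁₀), θ.Admissible → D = datumOfRecord₁₀ F N θ hP →
        (∀ P, w.up P = upOfRecord₅C F N (θ.toStage5₁₀ F N) P) →
        ∀ P : B12.RunParams, ∀ k, k < P.K → TLaw₁₀ F N θ P k → SLaw₁₀ F N θ P (k + 1)) ↔
      ∀ P : B12.RunParams, (w.up P).rOperation := by
  refine ⟨fun hT P => ?_, fun hw θ' hP' _ _ hup' P => ?_⟩
  · obtain ⟨θ, hP, hθ, hD, -, -, -, hup⟩ := h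
    rw [hup P]
    exact (rOperation_upOfRecord₅C_stage10_iff F N θ P).2 (hT θ hP hθ hD hup P)
  · have hR : (w.up P).rOperation := hw P
    rw [hup' P] at hR
    exact (rOperation_upOfRecord₅C_stage10_iff F N θ' P).1 hR

/-- **N03 · [Balaban1984PropagatorsII] IS A THEOREM AT EVERY RUN OF EVERY STAGE-10 RECORD** (seat dag-n03-a's `N03_at_record₅C`, chair R443, transferred through the
shadow by `atWorld_of_isRecordOfRecord₁₀C`). [cite: Balaban1984PropagatorsII, Lemma 2.1 – Cor. 2.8 pp.223–250 (kernel version of the lineage, transferred)] -/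
theorem N24_b6_main_of_isRecordOfRecord₁₀C (h : IsRecordOfRecord₁₀C F N D w) (P : B12.RunParams) : Dag.B6_main (leavesP w P) :=
  atWorld_of_isRecordOfRecord₁₀C (fun _ _ h5 P => N03_at_record₅C h5 P) h P

/-- **N05 · [Balaban1985RegularSpaces] at every run of a ₁₀C record from the θ-keyed [B8] socket** (`B8LeafKnit.b8_main_of_leaf`).
[cite: Balaban1985RegularSpaces, Thm 2 p.83, Thm 4 p.88, Thm 8 p.101 (node bookkeeping at the Stage-10 record)] -/
theorem N24_b8_main_of_isRecordOfRecord₁₀C_of_slot (h : IsRecordOfRecord₁₀C F N D w)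
    (slots₀₅ : ∀ (θ : Stage9Params F N) (hP : θ.Provisos₁₀), θ.Admissible → D = datumOfRecord₁₀ F N θ hP →
      (∀ P, w.up P = upOfRecord₅C F N (θ.toStage5₁₀ F N) P) → ∀ P : B12.RunParams,
        B8LeafR (θ.res.X P).d8 (θ.res.X P).L8 (θ.res.X P).C₂ (θ.res.X P).B₁' (θ.res.X P).B₀' (θ.res.X P).B₁ (θ.res.X P).B₂ (θ.res.X P).c₁
          (θ.res.X P).inp8 (θ.res.X P).B₀β (θ.res.X P).loc8 (θ.res.X P).fam8R (θ.res.X P).lan8 (θ.res.X P).cub8 (θ.res.X P).toAxial8)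
    (P : B12.RunParams) : Dag.B8_main (leavesP w P) :=
  B8LeafKnit.b8_main_of_leaf w P ((N24_forall_pinned_b8Leaf_iff₁₀C h).1 slots₀₅ P)

/-- **N06 · [Balaban1985BackgroundPropagators] at every run of a ₁₀C record from the θ-keyed [B9] socket** (in-edges unused).
[cite: Balaban1985BackgroundPropagators, Thms 3.1–3.15 pp.397–432 (node bookkeeping at the Stage-10 record)] -/
theorem N24_b9_main_of_isRecordOfRecord₁₀C_of_slot (h : IsRecordOfRecord₁₀C F N D w)
    (slots₀₆ : ∀ (θ : Stage9Params F N) (hP : θ.Provisos₁₀), θ.Admissible → D = datumOfRecord₁₀ F N θ hP →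
      (∀ P, w.up P = upOfRecord₅C F N (θ.toStage5₁₀ F N) P) → ∀ P : B12.RunParams, B9LeafX (θ.res.Y P))
    (P : B12.RunParams) : Dag.B9_main (leavesP w P) :=
  fun _ _ _ _ => (N24_forall_pinned_b9Leaf_iff₁₀C h).1 slots₀₆ P

/-- **N07 · [Balaban1985Variational] at every run of a ₁₀C record from the θ-keyed [B11] socket** (`B11LeafUnpinnedRecord.b11_main_of_upOfRecord₅C_of_b11Leaf` at the
Stage-10 view). [cite: Balaban1985Variational, Thm 1 p.279, Props 2–9 pp.281–309 (node bookkeeping at the Stage-10 record)] -/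
theorem N24_b11_main_of_isRecordOfRecord₁₀C_of_slot (h : IsRecordOfRecord₁₀C F N D w)
    (slots₀₇ : ∀ (θ : Stage9Params F N) (hP : θ.Provisos₁₀), θ.Admissible → D = datumOfRecord₁₀ F N θ hP →
      (∀ P, w.up P = upOfRecord₅C F N (θ.toStage5₁₀ F N) P) → ∀ P : B12.RunParams, B11Leaf (θ.res.Z P))
    (P : B12.RunParams) : Dag.B11_main (leavesP w P) := by
  obtain ⟨θ, hP, hθ, hD, -, -, -, hup⟩ := h
  exact B11LeafUnpinnedRecord.b11_main_of_upOfRecord₅C_of_b11Leaf (θ.toStage5₁₀ F N) P (hup P) (slots₀₇ θ hP hθ hD hup P)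

/-- **N08 · [Balaban1985UV3] (compact reading of record, chair R434) at every run of a ₁₀C record from the θ-keyed leaf-system slot**: the residual [B10] run family of
`θ.res.X P` is a family of leaf-system tower runs (`B10LeafUnpinnedRecord5C.b10_main_of_upOfRecord₅C_of_leafSystems` at the Stage-10 view; the [B10] carrier pin at
Stage 10 is `Record10Carriers`'). [cite: Balaban1985UV3, Thm 1 p.257 (compact reading) + Thm 2 p.272 (node bookkeeping at the Stage-10 record)] -/
theorem N24_b10_main_of_isRecordOfRecord₁₀C_of_slot (h : IsRecordOfRecord₁₀C F N D w)
    (slots₀₈ : ∀ (θ : Stage9Params F N) (hP : θ.Provisos₁₀), θ.Admissible → D = datumOfRecord₁₀ F N θ hP →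
      (∀ P, w.up P = upOfRecord₅C F N (θ.toStage5₁₀ F N) P) → ∀ P : B12.RunParams,
        ∃ (Xc : PrintedCarriersR) (I : Type) (C : B10Assembly.Consts) (T : I → B10.TowerRun),
          Nonempty (∀ i, B10Assembly.LeafSystem C (T i)) ∧ θ.res.X P = Xc.withTowerRuns10 T)
    (P : B12.RunParams) : Dag.B10_main (leavesP w P) := by
  obtain ⟨θ, hP, hθ, hD, -, -, -, hup⟩ := h
  obtain ⟨Xc, I, C, T, ⟨S⟩, hX⟩ := slots₀₈ θ hP hθ hD hup P
  exact B10LeafUnpinnedRecord5C.b10_main_of_upOfRecord₅C_of_leafSystems (θ.toStage5₁₀ F N) (hup P) Xc S hX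

/-- **N10 · [Balaban1988RG2Cluster] at every run of a ₁₀C record from the θ-keyed B13 socket** over the residual groups X ([B10] runs, B12, B13), Y, Z
(`B13NodeKnitRecord5C.b13_main_at_stage5ParamsC` at the Stage-10 view). [cite: Balaban1988RG2Cluster, Lemmas 1–3 pp.9, 11, 20 (node bookkeeping at the Stage-10 record)] -/
theorem N24_b13_main_of_isRecordOfRecord₁₀C_of_slot (h : IsRecordOfRecord₁₀C F N D w)
    (slots₁₀ : ∀ (θ : Stage9Params F N) (hP : θ.Provisos₁₀), θ.Admissible → D = datumOfRecord₁₀ F N θ hP →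
      (∀ P, w.up P = upOfRecord₅C F N (θ.toStage5₁₀ F N) P) → ∀ P : B12.RunParams,
        B9LeafX (θ.res.Y P) →
          (B10.Thm1PrintedCompact (θ.res.X P).runs10 ∧ B10.Thm2Printed (θ.res.X P).runs10) →
            B11Leaf (θ.res.Z P) → B12Sec2to5.Lemma4Printed (θ.res.X P).F12 (θ.res.X P).c12 →
              B13.Lemma1Printed (θ.res.X P).S13 (θ.res.X P).c13 ∧ B13.Lemma2Printed (θ.res.X P).S13 (θ.res.X P).c13 ∧
                B13.Lemma3Printed (θ.res.X P).S13 (θ.res.X P).c13)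
    (P : B12.RunParams) : Dag.B13_main (leavesP w P) := by
  obtain ⟨θ, hP, hθ, hD, -, -, -, hup⟩ := h
  exact B13NodeKnitRecord5C.b13_main_at_stage5ParamsC F N (θ.toStage5₁₀ F N) w P (hup P) (slots₁₀ θ hP hθ hD hup P)

/-- **N12 · [Balaban1989LargeFieldI] at every run of a ₁₀C record from the θ-keyed [IV] socket** (`B15LeafKnit.b15_main_of_up`).
[cite: Balaban1989LargeFieldI, Prop. 1 p.194, (1.80) p.195, (1.89) p.198, (1.99)–(1.100) p.201 (node bookkeeping at the Stage-10 record)] -/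
theorem N24_b15_main_of_isRecordOfRecord₁₀C_of_slot (h : IsRecordOfRecord₁₀C F N D w)
    (slots₁₂ : ∀ (θ : Stage9Params F N) (hP : θ.Provisos₁₀), θ.Admissible → D = datumOfRecord₁₀ F N θ hP →
      (∀ P, w.up P = upOfRecord₅C F N (θ.toStage5₁₀ F N) P) → ∀ P : B12.RunParams, B15Leaf (θ.res.W P))
    (P : B12.RunParams) : Dag.B15_main (leavesP w P) :=
  B15LeafKnit.b15_main_of_up (U := w.up P) rfl ((N24_forall_pinned_b15Leaf_iff₁₀C h).1 slots₁₂ P)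

/-! ## §1. (B2) at the Stage-10 record: the engine, and the children at θ by name -/

/-- **N24 · (B2) AT THE STAGE-10 RECORD — the composition ENGINE**: from the nine by-name binders N05 … N13 at every run of the world and the β-box
`w.b ≤ D.βfun ≤ w.βup` on `]0, γ₀]^{k+1}`, `γ₀ ≥ w.γ`: `B16.EndStatementBPrinted D.C`.  Module 5's `N24_at_record₅C` AT THE SHADOW `D₅` (`D₅.C = D.C` CONSUMED,
`D₅.βfun = D.βfun`), N03 a theorem there (`N03_at_record₅C`), N01 N02 N04 inside. [cite: Balaban1989LargeFieldII, Thm 1 p.355 + pp.387, 391; Balaban1988Convergent, Thm 1 p.262, (0.2) p.244; Balaban1987RG1, (1.22) p.264 (bookkeeping over the Stage-10 record)] -/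
theorem N24_at_record₁₀C (h : IsRecordOfRecord₁₀C F N D w) {γ₀ : ℝ} (hγ₀ : w.γ ≤ γ₀)
    (h05 : ∀ P : B12.RunParams, Dag.B8_main (leavesP w P)) (h06 : ∀ P : B12.RunParams, Dag.B9_main (leavesP w P))
    (h07 : ∀ P : B12.RunParams, Dag.B11_main (leavesP w P)) (h08 : ∀ P : B12.RunParams, Dag.B10_main (leavesP w P))
    (h09 : ∀ P : B12.RunParams, Dag.B12_main (leavesP w P)) (h10 : ∀ P : B12.RunParams, Dag.B13_main (leavesP w P))
    (h11 : ∀ P : B12.RunParams, Dag.B14_main (leavesP w P)) (h12 : ∀ P : B12.RunParams, Dag.B15_main (leavesP w P))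
    (h13 : ∀ P : B12.RunParams, Dag.B16_main (leavesP w P))
    (hlo : FlowStep.BetaLowerH w.b γ₀ D.βfun) (hhi : FlowStep.BetaUpperH w.βup γ₀ D.βfun) :
    B16.EndStatementBPrinted D.C := by
  obtain ⟨D₅, h₅, hC5, -, hβ, -⟩ := exists_isRecordOfRecord₅C_of_isRecordOfRecord₁₀C h
  have hlo' : FlowStep.BetaLowerH w.b γ₀ D₅.βfun := by rw [hβ]; exact hlo
  have hhi' : FlowStep.BetaUpperH w.βup γ₀ D₅.βfun := by rw [hβ]; exact hhi
  rw [← hC5]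
  exact N24_at_record₅C h₅ hγ₀ (N03_at_record₅C h₅) h05 h06 h07 h08 h09 h10 h11 h12 h13 hlo' hhi'

/-- **The engine with N13 in its ∃-exponent form** («for SOME dependence letters `(e₋, e₊)`, N13 at every run of `{ w with em := e₋, ep := e₊ }`» — (B2) does not read the
world's exponent letters; module 5's `N24_at_record₅C_of_N13_exists` at the shadow). [cite: Balaban1989LargeFieldII, Thm 1 p.355, (0.1) pp.355–356 («for some E₋, E₊»), p.391] -/
theorem N24_at_record₁₀C_of_N13_exists (h : IsRecordOfRecord₁₀C F N D w) {γ₀ : ℝ} (hγ₀ : w.γ ≤ γ₀)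
    (h05 : ∀ P : B12.RunParams, Dag.B8_main (leavesP w P)) (h06 : ∀ P : B12.RunParams, Dag.B9_main (leavesP w P))
    (h07 : ∀ P : B12.RunParams, Dag.B11_main (leavesP w P)) (h08 : ∀ P : B12.RunParams, Dag.B10_main (leavesP w P))
    (h09 : ∀ P : B12.RunParams, Dag.B12_main (leavesP w P)) (h10 : ∀ P : B12.RunParams, Dag.B13_main (leavesP w P))
    (h11 : ∀ P : B12.RunParams, Dag.B14_main (leavesP w P)) (h12 : ∀ P : B12.RunParams, Dag.B15_main (leavesP w P))
    (h13 : ∃ em ep : ℝ → ℝ, ∀ P : B12.RunParams, Dag.B16_main (leavesP { w with em := em, ep := ep } P))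
    (hlo : FlowStep.BetaLowerH w.b γ₀ D.βfun) (hhi : FlowStep.BetaUpperH w.βup γ₀ D.βfun) :
    B16.EndStatementBPrinted D.C := by
  obtain ⟨D₅, h₅, hC5, -, hβ, -⟩ := exists_isRecordOfRecord₅C_of_isRecordOfRecord₁₀C h
  have hlo' : FlowStep.BetaLowerH w.b γ₀ D₅.βfun := by rw [hβ]; exact hlo
  have hhi' : FlowStep.BetaUpperH w.βup γ₀ D₅.βfun := by rw [hβ]; exact hhi
  rw [← hC5]
  exact N24_at_record₅C_of_N13_exists h₅ hγ₀ (N03_at_record₅C h₅) h05 h06 h07 h08 h09 h10 h11 h12 h13 hlo' hhi'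

/-- **N24 · (B2) AT THE STAGE-10 RECORD, THE CARRIER CHILDREN AT THE RECORD'S OWN PARAMETERS BY NAME, N13 WORLD-LEVEL, N09 ∕ N11 BY-NAME BINDERS.**  N01 N02 N03 N04 theorems
(inside); N05 N06 N07 N12 θ-keyed pinned carrier sockets on the residual groups X ∕ Y ∕ Z ∕ W over `θ.toStage5₁₀` (§0); N08 the leaf-system slot; N10 the B13
socket; **N13** the record's 𝐑-leaf `hR : ∀ P, (w.up P).rOperation` — at Stage 10 = law transport along the tower of record `∀ k < K, TLaw₁₀ θ P k → SLaw₁₀ θ P (k+1)` for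
the presenting `θ` (`Record10.rOperation_upOfRecord₅C_stage10_iff`) — and «∃ (e₋, e₊) R, the five [Balaban1988Convergent] Cor.-3 leaves at `(D.C, w.γ)`» `hcor3` (seat
dag-n13-a's `B16NodeKnitRecordPinned.b16_main_of_isRecordOfRecord₅C_of_leaf` at the shadow, `D₅.C = D.C` consumed); **N09, N11** by-name binders (LOCATED: their Stage-10
faces — dag-n09-a's `B12NodeKnitRecord10` at `TcOfRecord ∕ chiFixed7`, the n11 ∕ n13 lineages' junction (S0) (S1ᵀ) (R₁₀) (UV₁₀) at `SLaw₁₀ ∕ TLaw₁₀ ∕ densOfRecord₁₀` — trigger on `Record10`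
and are consumed by name in this file's append-only successor); β-box on `D.βfun` over `]0, γ₀]`.  THE HYPOTHESIS LIST IS «WHICH CHILD BLOCKS AT ₁₀C» IN KERNEL FORM.
[cite: Balaban1989LargeFieldII, Thm 1 p.355, (0.1) pp.355–356, p.387, p.391; Balaban1988Convergent, Thm 1 p.262, Cor. 3 pp.283–284, p.244; Balaban1987RG1, Thm 3 p.264, (1.22) p.264; Balaban1985RegularSpaces, Thms 2, 4, 8 pp.83–101; Balaban1985BackgroundPropagators, Thms 3.1–3.15 pp.397–432; Balaban1985Variational, Thm 1 p.279; Balaban1985UV3, Thm 1 p.257 + Thm 2 p.272; Balaban1988RG2Cluster, Lemmas 1–3 pp.9, 11, 20; Balaban1989LargeFieldI, Prop. 1 p.194; Balaban1984PropagatorsII, pp.234–249 (bookkeeping over the Stage-10 record)] -/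
theorem N24_at_record₁₀C_knit_pinned (h : IsRecordOfRecord₁₀C F N D w) {γ₀ : ℝ} (hγ₀ : w.γ ≤ γ₀)
    (slots₀₅ : ∀ (θ : Stage9Params F N) (hP : θ.Provisos₁₀), θ.Admissible → D = datumOfRecord₁₀ F N θ hP →
      (∀ P, w.up P = upOfRecord₅C F N (θ.toStage5₁₀ F N) P) → ∀ P : B12.RunParams,
        B8LeafR (θ.res.X P).d8 (θ.res.X P).L8 (θ.res.X P).C₂ (θ.res.X P).B₁' (θ.res.X P).B₀' (θ.res.X P).B₁ (θ.res.X P).B₂ (θ.res.X P).c₁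
          (θ.res.X P).inp8 (θ.res.X P).B₀β (θ.res.X P).loc8 (θ.res.X P).fam8R (θ.res.X P).lan8 (θ.res.X P).cub8 (θ.res.X P).toAxial8)
    (slots₀₆ : ∀ (θ : Stage9Params F N) (hP : θ.Provisos₁₀), θ.Admissible → D = datumOfRecord₁₀ F N θ hP →
      (∀ P, w.up P = upOfRecord₅C F N (θ.toStage5₁₀ F N) P) → ∀ P : B12.RunParams, B9LeafX (θ.res.Y P))
    (slots₀₇ : ∀ (θ : Stage9Params F N) (hP : θ.Provisos₁₀), θ.Admissible → D = datumOfRecord₁₀ F N θ hP →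
      (∀ P, w.up P = upOfRecord₅C F N (θ.toStage5₁₀ F N) P) → ∀ P : B12.RunParams, B11Leaf (θ.res.Z P))
    (slots₀₈ : ∀ (θ : Stage9Params F N) (hP : θ.Provisos₁₀), θ.Admissible → D = datumOfRecord₁₀ F N θ hP →
      (∀ P, w.up P = upOfRecord₅C F N (θ.toStage5₁₀ F N) P) → ∀ P : B12.RunParams,
        ∃ (Xc : PrintedCarriersR) (I : Type) (C : B10Assembly.Consts) (T : I → B10.TowerRun),
          Nonempty (∀ i, B10Assembly.LeafSystem C (T i)) ∧ θ.res.X P = Xc.withTowerRuns10 T)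
    (h09 : ∀ P : B12.RunParams, Dag.B12_main (leavesP w P))
    (slots₁₀ : ∀ (θ : Stage9Params F N) (hP : θ.Provisos₁₀), θ.Admissible → D = datumOfRecord₁₀ F N θ hP →
      (∀ P, w.up P = upOfRecord₅C F N (θ.toStage5₁₀ F N) P) → ∀ P : B12.RunParams,
        B9LeafX (θ.res.Y P) →
          (B10.Thm1PrintedCompact (θ.res.X P).runs10 ∧ B10.Thm2Printed (θ.res.X P).runs10) →
            B11Leaf (θ.res.Z P) → B12Sec2to5.Lemma4Printed (θ.res.X P).F12 (θ.res.X P).c12 →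
              B13.Lemma1Printed (θ.res.X P).S13 (θ.res.X P).c13 ∧ B13.Lemma2Printed (θ.res.X P).S13 (θ.res.X P).c13 ∧
                B13.Lemma3Printed (θ.res.X P).S13 (θ.res.X P).c13)
    (h11 : ∀ P : B12.RunParams, Dag.B14_main (leavesP w P))
    (slots₁₂ : ∀ (θ : Stage9Params F N) (hP : θ.Provisos₁₀), θ.Admissible → D = datumOfRecord₁₀ F N θ hP →
      (∀ P, w.up P = upOfRecord₅C F N (θ.toStage5₁₀ F N) P) → ∀ P : B12.RunParams, B15Leaf (θ.res.W P))
    (hR : ∀ P : B12.RunParams, (w.up P).rOperation)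
    (hcor3 : ∃ (em ep : ℝ → ℝ) (R : B14Cor3.ReprFamily D.C),
      B14Cor3.LeafH D.C R w.γ ∧ B14Cor3.LeafU1 D.C R w.γ ∧ B14Cor3.LeafU2 D.C R w.γ ep ∧ B14Cor3.LeafL1 D.C R w.γ ∧ B14Cor3.LeafL2 D.C R w.γ em)
    (hlo : FlowStep.BetaLowerH w.b γ₀ D.βfun) (hhi : FlowStep.BetaUpperH w.βup γ₀ D.βfun) :
    B16.EndStatementBPrinted D.C := by
  have h05 := N24_b8_main_of_isRecordOfRecord₁₀C_of_slot h slots₀₅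
  have h06 := N24_b9_main_of_isRecordOfRecord₁₀C_of_slot h slots₀₆
  have h07 := N24_b11_main_of_isRecordOfRecord₁₀C_of_slot h slots₀₇
  have h08 := N24_b10_main_of_isRecordOfRecord₁₀C_of_slot h slots₀₈
  have h10 := N24_b13_main_of_isRecordOfRecord₁₀C_of_slot h slots₁₀
  have h12 := N24_b15_main_of_isRecordOfRecord₁₀C_of_slot h slots₁₂
  obtain ⟨D₅, h₅, hC5, -, hβ, -⟩ := exists_isRecordOfRecord₅C_of_isRecordOfRecord₁₀C h
  have hlo' : FlowStep.BetaLowerH w.b γ₀ D₅.βfun := by rw [hβ]; exact hlo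
  have hhi' : FlowStep.BetaUpperH w.βup γ₀ D₅.βfun := by rw [hβ]; exact hhi
  rw [← hC5] at hcor3 ⊢
  obtain ⟨em, ep, R, hH, hU1, hU2, hL1, hL2⟩ := hcor3
  exact N24_at_record₅C_of_N13_exists h₅ hγ₀ (N03_at_record₅C h₅) h05 h06 h07 h08 h09 h10 h11 h12
    ⟨em, ep, N24_b16_main_withExp_of_cor3Leaves₅C h₅ hR em ep R hH hU1 hU2 hL1 hL2⟩ hlo' hhi'

/-! ## §2. The β OF RECORD AT STAGE 10 READ AT THE MERGED β OVER THE CONTINUOUS-VERSION TRANSPORT (RIDER №6 ∕ LINE №45 (2) executed by `Record10`) -/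

/-- **T-GENERIC: a LOWER box bound on `betaOfRecord₈T F N T θ` over `]0, γ']^{k+1}`, `γ' ≤ θ.γ`, IS the same bound on the MERGED β
`betaMerged F (mergedTermFamilyMatT F N T (chiFixed7 F N θ.ν) θ.εbg) θ.ρ8 θ.bV`** — `betaOfRecord₈T = betaOfMerged βm β⁰ θ.γ`, equal to `βm` on `Box θ.γ k ⊇ Box γ' k`
(`betaOfMerged_of_mem`, `FlowStep.box_mono`; module 10's `N24_betaLowerH_iff_merged₈`, T-generic). [cite: Balaban1987RG1, (1.20)–(1.22) p.264 and (2.12)–(2.14) p.268 (the β of record vs the merged β; bookkeeping)] -/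
theorem N24_betaLowerH_iff_mergedT (T : Transport F N) (θ : Stage8Params F N) {γ' b : ℝ} (hγ' : γ' ≤ θ.γ) :
    FlowStep.BetaLowerH b γ' (betaOfRecord₈T F N T θ) ↔
      (letI := θ.instVβ₁; letI := θ.instVβ₂; letI := θ.instιβ
       FlowStep.BetaLowerH b γ' (betaMerged F (mergedTermFamilyMatT F N T (chiFixed7 F N θ.ν) θ.εbg) θ.ρ8 θ.bV)) := by
  unfold betaOfRecord₈T
  refine ⟨fun h k v hv => ?_, fun h k v hv => ?_⟩
  · have h' := h k v hv
    rw [betaOfMerged_of_mem _ _ _ (FlowStep.box_mono hγ' k hv)] at h'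
    exact h'
  · rw [betaOfMerged_of_mem _ _ _ (FlowStep.box_mono hγ' k hv)]
    exact h k v hv

/-- **T-GENERIC: the same for an UPPER box bound.** [cite: Balaban1987RG1, (1.20)–(1.22) p.264 and (2.12)–(2.14) p.268 (bookkeeping)] -/
theorem N24_betaUpperH_iff_mergedT (T : Transport F N) (θ : Stage8Params F N) {γ' β' : ℝ} (hγ' : γ' ≤ θ.γ) :
    FlowStep.BetaUpperH β' γ' (betaOfRecord₈T F N T θ) ↔
      (letI := θ.instVβ₁; letI := θ.instVβ₂; letI := θ.instιβ
       FlowStep.BetaUpperH β' γ' (betaMerged F (mergedTermFamilyMatT F N T (chiFixed7 F N θ.ν) θ.εbg) θ.ρ8 θ.bV)) := by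
  unfold betaOfRecord₈T
  refine ⟨fun h k v hv => ?_, fun h k v hv => ?_⟩
  · have h' := h k v hv
    rw [betaOfMerged_of_mem _ _ _ (FlowStep.box_mono hγ' k hv)] at h'
    exact h'
  · rw [betaOfMerged_of_mem _ _ _ (FlowStep.box_mono hγ' k hv)]
    exact h k v hv

/-- **At a Stage-10 presentation `D = datumOfRecord₁₀ F N θ hP`, `γ' ≤ θ.γ`: a LOWER box bound on `D.βfun` IS the same bound on the MERGED β over the continuous-version
transport** — `D.βfun = betaOfRecord₁₀ θ = betaOfRecord₉c θ = betaOfRecord₈T (TcOfRecord) θ.toStage8Params` (seat node00-def-T's face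
`Record10.βfun_datumOfRecord₁₀_eq_betaOfRecord₈T`, by name).
β-VERSION (RIDER №6 executed): β read through `TcOfRecord` with def-χ's `chiFixed7`; point values determined by the a.e.-class under the record's `contT`.
[cite: Balaban1987RG1, (0.19) p.255, (1.20)–(1.22) p.264, (2.12)–(2.14) p.268 (bookkeeping)] -/
theorem N24_betaLowerH_iff_merged₁₀ (θ : Stage9Params F N) (hP : θ.Provisos₁₀) (hD : D = datumOfRecord₁₀ F N θ hP) {γ' b : ℝ} (hγ' : γ' ≤ θ.γ) :
    FlowStep.BetaLowerH b γ' D.βfun ↔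
      (letI := θ.instVβ₁; letI := θ.instVβ₂; letI := θ.instιβ
       FlowStep.BetaLowerH b γ' (betaMerged F (mergedTermFamilyMatT F N (TcOfRecord F N) (chiFixed7 F N θ.ν) θ.εbg) θ.ρ8 θ.bV)) := by
  have hβ : D.βfun = betaOfRecord₈T F N (TcOfRecord F N) θ.toStage8Params := by
    rw [hD]; exact βfun_datumOfRecord₁₀_eq_betaOfRecord₈T F N θ hP
  rw [hβ]
  exact N24_betaLowerH_iff_mergedT (TcOfRecord F N) θ.toStage8Params hγ'

/-- **The same for an UPPER box bound** at a Stage-10 presentation. [cite: Balaban1987RG1, (0.19) p.255, (1.20)–(1.22) p.264, (2.12)–(2.14) p.268 (bookkeeping)] -/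
theorem N24_betaUpperH_iff_merged₁₀ (θ : Stage9Params F N) (hP : θ.Provisos₁₀) (hD : D = datumOfRecord₁₀ F N θ hP) {γ' β' : ℝ} (hγ' : γ' ≤ θ.γ) :
    FlowStep.BetaUpperH β' γ' D.βfun ↔
      (letI := θ.instVβ₁; letI := θ.instVβ₂; letI := θ.instιβ
       FlowStep.BetaUpperH β' γ' (betaMerged F (mergedTermFamilyMatT F N (TcOfRecord F N) (chiFixed7 F N θ.ν) θ.εbg) θ.ρ8 θ.bV)) := by
  have hβ : D.βfun = betaOfRecord₈T F N (TcOfRecord F N) θ.toStage8Params := by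
    rw [hD]; exact βfun_datumOfRecord₁₀_eq_betaOfRecord₈T F N θ hP
  rw [hβ]
  exact N24_betaUpperH_iff_mergedT (TcOfRecord F N) θ.toStage8Params hγ'

/-- **N24 · (B2) at the Stage-10 record, the children as in `N24_at_record₁₀C_knit_pinned`, with the β-binders READ AT THE MERGED β OVER THE CONTINUOUS-VERSION
TRANSPORT along the world's own box `]0, w.γ]^{k+1}`** (§2's iffs at the record's presenting `θ`).  WHICH CHILD BLOCKS at ₁₀C, kernel form: the hypothesis list —
six residual-carrier sockets ∕ slots (X-[B8] ∕ [B10] ∕ B13, Y, Z, W — `Record10Carriers`), N13's 𝐑-leaf (= law transport along the Stage-10 tower) and Cor.-3 leaves,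
the by-name binders N09 and N11 (their Stage-10 faces pending), and two bounds on the merged β over `TcOfRecord` (lower `b > 0` UNPRINTED, T09.F = NODE O; upper β⁺
[Balaban1987RG1] p. 264).  β-VERSION (RIDER №6 executed at Stage 10): continuous-version transport, χ fixed-threshold; β-side binders are bounds on THIS β.
[cite: Balaban1989LargeFieldII, Thm 1 p.355, (0.1) pp.355–356, p.387, p.391; Balaban1987RG1, (0.19) p.255, (1.20)–(1.22) p.264, (2.12)–(2.14) p.268, Thm 3 p.264; Balaban1988Convergent, Thm 1 p.262, Cor. 3 pp.283–284, p.244 (bookkeeping over the Stage-10 record)] -/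
theorem N24_at_record₁₀C_knit_of_betaMerged_pinned (h : IsRecordOfRecord₁₀C F N D w)
    (slots₀₅ : ∀ (θ : Stage9Params F N) (hP : θ.Provisos₁₀), θ.Admissible → D = datumOfRecord₁₀ F N θ hP →
      (∀ P, w.up P = upOfRecord₅C F N (θ.toStage5₁₀ F N) P) → ∀ P : B12.RunParams,
        B8LeafR (θ.res.X P).d8 (θ.res.X P).L8 (θ.res.X P).C₂ (θ.res.X P).B₁' (θ.res.X P).B₀' (θ.res.X P).B₁ (θ.res.X P).B₂ (θ.res.X P).c₁
          (θ.res.X P).inp8 (θ.res.X P).B₀β (θ.res.X P).loc8 (θ.res.X P).fam8R (θ.res.X P).lan8 (θ.res.X P).cub8 (θ.res.X P).toAxial8)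
    (slots₀₆ : ∀ (θ : Stage9Params F N) (hP : θ.Provisos₁₀), θ.Admissible → D = datumOfRecord₁₀ F N θ hP →
      (∀ P, w.up P = upOfRecord₅C F N (θ.toStage5₁₀ F N) P) → ∀ P : B12.RunParams, B9LeafX (θ.res.Y P))
    (slots₀₇ : ∀ (θ : Stage9Params F N) (hP : θ.Provisos₁₀), θ.Admissible → D = datumOfRecord₁₀ F N θ hP →
      (∀ P, w.up P = upOfRecord₅C F N (θ.toStage5₁₀ F N) P) → ∀ P : B12.RunParams, B11Leaf (θ.res.Z P))
    (slots₀₈ : ∀ (θ : Stage9Params F N) (hP : θ.Provisos₁₀), θ.Admissible → D = datumOfRecord₁₀ F N θ hP →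
      (∀ P, w.up P = upOfRecord₅C F N (θ.toStage5₁₀ F N) P) → ∀ P : B12.RunParams,
        ∃ (Xc : PrintedCarriersR) (I : Type) (C : B10Assembly.Consts) (T : I → B10.TowerRun),
          Nonempty (∀ i, B10Assembly.LeafSystem C (T i)) ∧ θ.res.X P = Xc.withTowerRuns10 T)
    (h09 : ∀ P : B12.RunParams, Dag.B12_main (leavesP w P))
    (slots₁₀ : ∀ (θ : Stage9Params F N) (hP : θ.Provisos₁₀), θ.Admissible → D = datumOfRecord₁₀ F N θ hP →
      (∀ P, w.up P = upOfRecord₅C F N (θ.toStage5₁₀ F N) P) → ∀ P : B12.RunParams,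
        B9LeafX (θ.res.Y P) →
          (B10.Thm1PrintedCompact (θ.res.X P).runs10 ∧ B10.Thm2Printed (θ.res.X P).runs10) →
            B11Leaf (θ.res.Z P) → B12Sec2to5.Lemma4Printed (θ.res.X P).F12 (θ.res.X P).c12 →
              B13.Lemma1Printed (θ.res.X P).S13 (θ.res.X P).c13 ∧ B13.Lemma2Printed (θ.res.X P).S13 (θ.res.X P).c13 ∧
                B13.Lemma3Printed (θ.res.X P).S13 (θ.res.X P).c13)
    (h11 : ∀ P : B12.RunParams, Dag.B14_main (leavesP w P))
    (slots₁₂ : ∀ (θ : Stage9Params F N) (hP : θ.Provisos₁₀), θ.Admissible → D = datumOfRecord₁₀ F N θ hP →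
      (∀ P, w.up P = upOfRecord₅C F N (θ.toStage5₁₀ F N) P) → ∀ P : B12.RunParams, B15Leaf (θ.res.W P))
    (hR : ∀ P : B12.RunParams, (w.up P).rOperation)
    (hcor3 : ∃ (em ep : ℝ → ℝ) (R : B14Cor3.ReprFamily D.C),
      B14Cor3.LeafH D.C R w.γ ∧ B14Cor3.LeafU1 D.C R w.γ ∧ B14Cor3.LeafU2 D.C R w.γ ep ∧ B14Cor3.LeafL1 D.C R w.γ ∧ B14Cor3.LeafL2 D.C R w.γ em)
    (hβm : ∀ (θ : Stage9Params F N) (hP : θ.Provisos₁₀), θ.Admissible → D = datumOfRecord₁₀ F N θ hP → w.γ ≤ θ.γ →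
      letI := θ.instVβ₁; letI := θ.instVβ₂; letI := θ.instιβ
      FlowStep.BetaLowerH w.b w.γ (betaMerged F (mergedTermFamilyMatT F N (TcOfRecord F N) (chiFixed7 F N θ.ν) θ.εbg) θ.ρ8 θ.bV) ∧
        FlowStep.BetaUpperH w.βup w.γ (betaMerged F (mergedTermFamilyMatT F N (TcOfRecord F N) (chiFixed7 F N θ.ν) θ.εbg) θ.ρ8 θ.bV)) :
    B16.EndStatementBPrinted D.C := by
  obtain ⟨θ, hP, hθ, hD, -, hγ, -, -⟩ := id h
  obtain ⟨hlo, hhi⟩ := hβm θ hP hθ hD hγ.2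
  exact N24_at_record₁₀C_knit_pinned h le_rfl slots₀₅ slots₀₆ slots₀₇ slots₀₈ h09 slots₁₀ h11 slots₁₂ hR hcor3
    ((N24_betaLowerH_iff_merged₁₀ θ hP hD hγ.2).mpr hlo) ((N24_betaUpperH_iff_merged₁₀ θ hP hD hγ.2).mpr hhi)

/-! ## §3. The item body in its literal shape at a Stage-10 record -/

/-- **The item body (stmt-QuantumFields-19183 `StabilityBAtRecord`, rev 0) in its LITERAL SHAPE at general `N`, at a STAGE-10 record**, children as in
`N24_at_record₁₀C_knit_pinned`: `IsDatumOfRecord₀ F N D ∧ B16.EndStatementBPrinted D.C ∧ ∃ γ₁ > 0, ∀ γ ∈ ]0, γ₁], ∃ P, (D.C P).flow.InInterval γ P.K` — Stage 0 from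
the record (`isDatumOfRecord₀_of_isRecordOfRecord₁₀C`), (B2) by §1, `γ₁ := γ₀` and the run `⟨K, m, g₀⟩` of module 8's K-indexed window (`N24_window_allK_of_betaUpperH`,
from `hhi` alone). [cite: Balaban1989LargeFieldII, Thm 1 p.355 + p.391; Balaban1987RG1, (0.4) p.253, (0.18)–(0.20) pp.255–256 and p.264 (bookkeeping + elementary window)] -/
theorem N24_stabilityB_itemShape₁₀C_knit_pinned (h : IsRecordOfRecord₁₀C F N D w) {γ₀ : ℝ} (hγ₀ : w.γ ≤ γ₀) (K m : ℕ)
    (slots₀₅ : ∀ (θ : Stage9Params F N) (hP : θ.Provisos₁₀), θ.Admissible → D = datumOfRecord₁₀ F N θ hP →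
      (∀ P, w.up P = upOfRecord₅C F N (θ.toStage5₁₀ F N) P) → ∀ P : B12.RunParams,
        B8LeafR (θ.res.X P).d8 (θ.res.X P).L8 (θ.res.X P).C₂ (θ.res.X P).B₁' (θ.res.X P).B₀' (θ.res.X P).B₁ (θ.res.X P).B₂ (θ.res.X P).c₁
          (θ.res.X P).inp8 (θ.res.X P).B₀β (θ.res.X P).loc8 (θ.res.X P).fam8R (θ.res.X P).lan8 (θ.res.X P).cub8 (θ.res.X P).toAxial8)
    (slots₀₆ : ∀ (θ : Stage9Params F N) (hP : θ.Provisos₁₀), θ.Admissible → D = datumOfRecord₁₀ F N θ hP →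
      (∀ P, w.up P = upOfRecord₅C F N (θ.toStage5₁₀ F N) P) → ∀ P : B12.RunParams, B9LeafX (θ.res.Y P))
    (slots₀₇ : ∀ (θ : Stage9Params F N) (hP : θ.Provisos₁₀), θ.Admissible → D = datumOfRecord₁₀ F N θ hP →
      (∀ P, w.up P = upOfRecord₅C F N (θ.toStage5₁₀ F N) P) → ∀ P : B12.RunParams, B11Leaf (θ.res.Z P))
    (slots₀₈ : ∀ (θ : Stage9Params F N) (hP : θ.Provisos₁₀), θ.Admissible → D = datumOfRecord₁₀ F N θ hP →
      (∀ P, w.up P = upOfRecord₅C F N (θ.toStage5₁₀ F N) P) → ∀ P : B12.RunParams,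
        ∃ (Xc : PrintedCarriersR) (I : Type) (C : B10Assembly.Consts) (T : I → B10.TowerRun),
          Nonempty (∀ i, B10Assembly.LeafSystem C (T i)) ∧ θ.res.X P = Xc.withTowerRuns10 T)
    (h09 : ∀ P : B12.RunParams, Dag.B12_main (leavesP w P))
    (slots₁₀ : ∀ (θ : Stage9Params F N) (hP : θ.Provisos₁₀), θ.Admissible → D = datumOfRecord₁₀ F N θ hP →
      (∀ P, w.up P = upOfRecord₅C F N (θ.toStage5₁₀ F N) P) → ∀ P : B12.RunParams,
        B9LeafX (θ.res.Y P) →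
          (B10.Thm1PrintedCompact (θ.res.X P).runs10 ∧ B10.Thm2Printed (θ.res.X P).runs10) →
            B11Leaf (θ.res.Z P) → B12Sec2to5.Lemma4Printed (θ.res.X P).F12 (θ.res.X P).c12 →
              B13.Lemma1Printed (θ.res.X P).S13 (θ.res.X P).c13 ∧ B13.Lemma2Printed (θ.res.X P).S13 (θ.res.X P).c13 ∧
                B13.Lemma3Printed (θ.res.X P).S13 (θ.res.X P).c13)
    (h11 : ∀ P : B12.RunParams, Dag.B14_main (leavesP w P))
    (slots₁₂ : ∀ (θ : Stage9Params F N) (hP : θ.Provisos₁₀), θ.Admissible → D = datumOfRecord₁₀ F N θ hP →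
      (∀ P, w.up P = upOfRecord₅C F N (θ.toStage5₁₀ F N) P) → ∀ P : B12.RunParams, B15Leaf (θ.res.W P))
    (hR : ∀ P : B12.RunParams, (w.up P).rOperation)
    (hcor3 : ∃ (em ep : ℝ → ℝ) (R : B14Cor3.ReprFamily D.C),
      B14Cor3.LeafH D.C R w.γ ∧ B14Cor3.LeafU1 D.C R w.γ ∧ B14Cor3.LeafU2 D.C R w.γ ep ∧ B14Cor3.LeafL1 D.C R w.γ ∧ B14Cor3.LeafL2 D.C R w.γ em)
    (hlo : FlowStep.BetaLowerH w.b γ₀ D.βfun) (hhi : FlowStep.BetaUpperH w.βup γ₀ D.βfun) :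
    IsDatumOfRecord₀ F N D ∧ B16.EndStatementBPrinted D.C ∧
      ∃ γ₁ : ℝ, 0 < γ₁ ∧ ∀ γ : ℝ, 0 < γ → γ ≤ γ₁ → ∃ P : B12.RunParams, (D.C P).flow.InInterval γ P.K := by
  refine ⟨isDatumOfRecord₀_of_isRecordOfRecord₁₀C h,
    N24_at_record₁₀C_knit_pinned h hγ₀ slots₀₅ slots₀₆ slots₀₇ slots₀₈ h09 slots₁₀ h11 slots₁₂ hR hcor3 hlo hhi,
    γ₀, (gamma_pos_of_isRecordOfRecord₁₀C h).trans_le hγ₀, fun γ hγ hγle => ?_⟩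
  obtain ⟨g0, -, hrun⟩ := N24_window_allK_of_betaUpperH D hhi hγ hγle m K
  exact ⟨⟨K, m, g0⟩, hrun⟩

/-! ## §4. ₁₀C is closed under γ-lowering re-lettering of the world (the `hRL` of design E) -/

/-- **Re-lettering a Stage-10 record's world** — new interval letter `γ' ∈ ]0, w.γ]`, any lower letter `b' > 0`, any upper letter `βup'`, any exponent letters `(e₋, e₊)`,
same `C`, `up`, `L` — gives again a Stage-10 record over the SAME datum (the window clause is `0 < w.γ ≤ θ.γ`; nothing else reads a world letter).  The `hRL` hypothesis
of the design-E faces (module 7) for `Rec := IsRecordOfRecord₁₀C` — NOT instantiated (X, Y, Z, W residual at Stage 10; `Record10Carriers` pins them).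
[cite: Balaban1989LargeFieldII, Thm 1 p.355 («γ sufficiently small»; bookkeeping)] -/
theorem N24_isRecordOfRecord₁₀C_reletter (h : IsRecordOfRecord₁₀C F N D w) {γ' b' : ℝ} (hγ' : 0 < γ') (hγ'le : γ' ≤ w.γ) (hb' : 0 < b') (βup' : ℝ)
    (em ep : ℝ → ℝ) :
    IsRecordOfRecord₁₀C F N D { w with γ := γ', b := b', b_pos := hb', βup := βup', em := em, ep := ep } := by
  obtain ⟨θ, hP, hθ, hD, hC, hγ, hL, hup⟩ := h
  exact ⟨θ, hP, hθ, hD, hC, ⟨hγ', hγ'le.trans hγ.2⟩, hL, hup⟩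

/-! ## §5. The socket display is strength-neutral at ₁₀C -/

/-- **LOGICAL STATUS of the socket display at a Stage-10 record** (module 14's `N24_leaves_iff_binders₅C` through the shadow): GIVEN N08, the four world leaves
`b8 ∧ b9 ∧ b11 ∧ rBasicStep` at every run (⇔ the four θ-keyed sockets of §0) are EQUIVALENT to the four by-name binders N05 ∧ N06 ∧ N07 ∧ N12 — replacing binders by
sockets is census-NEUTRAL in strength and census-POSITIVE in location. [cite: Balaban1985RegularSpaces, Thm 8 p.101; Balaban1985BackgroundPropagators, Thm 3.15 p.432; Balaban1985Variational, Thm 1 p.279; Balaban1989LargeFieldI, Prop. 1 p.194 (bookkeeping)] -/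
theorem N24_leaves_iff_binders₁₀C (h : IsRecordOfRecord₁₀C F N D w) (h08 : ∀ P : B12.RunParams, Dag.B10_main (leavesP w P)) :
    ((∀ P : B12.RunParams, (w.up P).b8) ∧ (∀ P : B12.RunParams, (w.up P).b9) ∧ (∀ P : B12.RunParams, (w.up P).b11) ∧
        ∀ P : B12.RunParams, (w.up P).rBasicStep) ↔
      ((∀ P : B12.RunParams, Dag.B8_main (leavesP w P)) ∧ (∀ P : B12.RunParams, Dag.B9_main (leavesP w P)) ∧
        (∀ P : B12.RunParams, Dag.B11_main (leavesP w P)) ∧ ∀ P : B12.RunParams, Dag.B15_main (leavesP w P)) := by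
  obtain ⟨D₅, h₅, -⟩ := exists_isRecordOfRecord₅C_of_isRecordOfRecord₁₀C h
  exact N24_leaves_iff_binders₅C h₅ h08

end Literature.MathematicalPhysics.QuantumFieldTheory.Balaban1983to89.Node00

end
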